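import Summits.QuantumFields.YangMills.Theorems.TwistEaterVolumeTauberUniform
import HarnessLib

/-!
# The uniform two-sided Tauberian sandwich with a POWER remainder `κ·t^θ`
# (support of LINE «sharp-sigma» on crux ⟨stmt-QuantumFields-24197⟩ `SwapVirialDeficit.SwapGluedStiffness`: the σ-glued state density has
# relative corrections `t^{1/4}`, not `t`, so ✓`Tauber.tauber_sandwich` (`κ·t`, item 24321) does not apply verbatim)

For a probability measure `μ`, a measurable `F ≥ 0` with `|μ{F ≤ t}/(v·t^N) − 1| ≤ κ·t^θ` on `(0, t₀]` (`0 < θ ≤ 1`), and every `β ≥ 4`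
with `κ(N+2)β^{−θ} ≤ 1/4` and `64(N+2)²(1 + |log v| + |log t₀| + log β) ≤ β·t₀`:
★★ `tauber_sandwich_rpow`: `|log ∫ e^{−βF} dμ − (log v + log N! − N·log β)| ≤ 2κ(N+2)·β^{−θ} + 2/β`.
Proof = ✓`tauber_sandwich` with the remainder `κ s^θ` bounded pointwise by Young's inequality `s^θ ≤ β^{−θ}(βs + 1)` (§1), so that the two
Gamma integrals `∫ s^N e^{−βs}`, `∫ s^{N+1} e^{−βs}` of the linear case reappear with the weights `κβ^{−θ}` and `κβ^{1−θ}`; the truncation and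
far tails are ✓`window_truncation_tail` / ✓`window_far_tail` unchanged.
HONEST LABEL: pure measure theory / real analysis; no crux, rung or summit statement is proved; the Yang–Mills mass gap is NOT proved; no summit
is proved by a line.  Seat ym-line-fcl-p3 g43 (cell ym-idea-1, free hands), `--supports stmt-QuantumFields-24197`.  THEOREMS ONLY, standard
axioms.  References: [cite: Griffiths1964]; [folklore].
-/

set_option autoImplicit false

noncomputable section

namespace Summit.QuantumFields.YangMills.Theorems.SwapVirialDeficit.SharpSigma

open MeasureTheory Set Filter Real
open scoped Nat Topology
open Summit.QuantumFields.YangMills.Theorems.TwistEaterVolume.Tauber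

/-! ## §1 Young's inequality for the power remainder -/

/-- `s^θ ≤ β^{−θ}·(βs + 1)` for `s ≥ 0`, `β > 0`, `0 < θ ≤ 1` (weighted AM–GM for `(βs)^θ·1^{1−θ}`). [folklore] -/
theorem rpow_le_rpow_neg_mul_linear {s β θ : ℝ} (hs : 0 ≤ s) (hβ : 0 < β) (hθ : 0 < θ) (hθ1 : θ ≤ 1) :
    s ^ θ ≤ β ^ (-θ) * (β * s + 1) := by
  have hbs : 0 ≤ β * s := by positivity
  have h := Real.geom_mean_le_arith_mean2_weighted (w₁ := θ) (w₂ := 1 - θ) (p₁ := β * s) (p₂ := 1) hθ.le (by linarith) hbs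
    zero_le_one (by ring)
  rw [Real.one_rpow, mul_one] at h
  have h2 : (β * s) ^ θ ≤ β * s + 1 := by nlinarith [h, hθ1, hbs, hθ.le]
  have h3 : (β * s) ^ θ = β ^ θ * s ^ θ := Real.mul_rpow hβ.le hs
  have h4 : β ^ (-θ) * β ^ θ = 1 := by
    rw [Real.rpow_neg hβ.le, inv_mul_cancel₀ (ne_of_gt (Real.rpow_pos_of_pos hβ θ))]
  calc s ^ θ = β ^ (-θ) * (β * s) ^ θ := by rw [h3, ← mul_assoc, h4, one_mul]
    _ ≤ β ^ (-θ) * (β * s + 1) := mul_le_mul_of_nonneg_left h2 (Real.rpow_nonneg hβ.le _)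

/-! ## §2 The sandwich with a power remainder -/

/-- ★★ **UNIFORM TWO-SIDED TAUBERIAN SANDWICH, power remainder**: for a probability measure `μ`, a measurable `F ≥ 0` with
`|μ{F ≤ t}/(v·t^N) − 1| ≤ κ·t^θ` on `(0, t₀]` (`0 < θ ≤ 1`), and every `β ≥ 4` with `κ(N+2)β^{−θ} ≤ 1/4` and
`64(N+2)²(1 + |log v| + |log t₀| + log β) ≤ β·t₀`: `|log ∫ e^{−βF} dμ − (log v + log N! − N·log β)| ≤ 2κ(N+2)β^{−θ} + 2/β`.
[cite: Griffiths1964] -/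
theorem tauber_sandwich_rpow {Ω : Type*} [MeasurableSpace Ω] (μ : Measure Ω) [IsProbabilityMeasure μ]
    (F : Ω → ℝ) (N : ℕ) (v κ θ t₀ : ℝ) (hF : Measurable F) (hF0 : ∀ ω, 0 ≤ F ω) (hv : 0 < v)
    (ht₀ : 0 < t₀) (hκ : 0 ≤ κ) (hθ : 0 < θ) (hθ1 : θ ≤ 1)
    (hvol : ∀ t : ℝ, 0 < t → t ≤ t₀ → |μ.real {ω | F ω ≤ t} / (v * t ^ N) - 1| ≤ κ * t ^ θ)
    {β : ℝ} (hβ4 : 4 ≤ β) (hβκ : κ * ((N : ℝ) + 2) * β ^ (-θ) ≤ 1 / 4)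
    (hwin : 64 * ((N : ℝ) + 2) ^ 2 * (1 + |Real.log v| + |Real.log t₀| + Real.log β) ≤ β * t₀) :
    |Real.log (∫ ω, rexp (-(β * F ω)) ∂μ) - (Real.log v + Real.log (N ! : ℝ) - N * Real.log β)|
      ≤ 2 * κ * ((N : ℝ) + 2) * β ^ (-θ) + 2 / β := by
  have hβ2 : 2 ≤ β := by linarith
  have hβ : 0 < β := by linarith
  have hN0 : (0:ℝ) ≤ N := Nat.cast_nonneg N
  have hfact_succ : ((N + 1) ! : ℝ) = (N + 1) * N ! := by
    push_cast [Nat.factorial_succ]; ring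
  -- the remainder weight `A = κ β^{−θ}`
  set A : ℝ := κ * β ^ (-θ) with hA
  have hA0 : 0 ≤ A := by rw [hA]; exact mul_nonneg hκ (Real.rpow_nonneg hβ.le _)
  have hAN : A * ((N : ℝ) + 2) ≤ 1 / 4 := by rw [hA]; linarith [hβκ, show κ * β ^ (-θ) * ((N : ℝ) + 2) = κ * ((N : ℝ) + 2) * β ^ (-θ) by ring]
  have hA1 : A ≤ 1 := by nlinarith [hAN, hN0, hA0]
  -- the pieces
  have hI := integral_exp_neg_mul_eq_integral_sublevel (μ := μ) F hF hF0 hβ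
  have hintgG := integrableOn_mul_exp_neg_mul_mul_sublevel (μ := μ) F hβ
  have hφN := integrableOn_pow_mul_exp_neg_mul_Ioi N hβ
  have hφN1 := integrableOn_pow_mul_exp_neg_mul_Ioi (N + 1) hβ
  -- split the layer-cake integral at `t₀`
  have hsplit : ∫ s in Ioi 0, β * rexp (-(β * s)) * μ.real {ω | F ω ≤ s}
      = (∫ s in Ioc 0 t₀, β * rexp (-(β * s)) * μ.real {ω | F ω ≤ s})
        + ∫ s in Ioi t₀, β * rexp (-(β * s)) * μ.real {ω | F ω ≤ s} := by
    rw [← setIntegral_union (Ioc_disjoint_Ioi le_rfl) measurableSet_Ioi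
      (hintgG.mono_set Ioc_subset_Ioi_self) (hintgG.mono_set (Ioi_subset_Ioi ht₀.le)),
      Ioc_union_Ioi_eq_Ioi ht₀.le]
  -- far tail: `0 ≤ J₂ ≤ e^{−βt₀}`
  have hJ2nn : 0 ≤ ∫ s in Ioi t₀, β * rexp (-(β * s)) * μ.real {ω | F ω ≤ s} :=
    setIntegral_nonneg measurableSet_Ioi fun s _ =>
      mul_nonneg (by positivity) measureReal_nonneg
  have hJ2le : ∫ s in Ioi t₀, β * rexp (-(β * s)) * μ.real {ω | F ω ≤ s} ≤ rexp (-(β * t₀)) := by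
    calc ∫ s in Ioi t₀, β * rexp (-(β * s)) * μ.real {ω | F ω ≤ s}
        ≤ ∫ s in Ioi t₀, β * rexp (-(β * s)) :=
          setIntegral_mono_on (hintgG.mono_set (Ioi_subset_Ioi ht₀.le))
            (integrableOn_mul_exp_neg_mul_Ioi hβ t₀) measurableSet_Ioi
            fun s _ => mul_le_of_le_one_right (by positivity) measureReal_le_one
      _ = rexp (-(β * t₀)) := integral_mul_exp_neg_mul_Ioi hβ t₀
  -- pointwise sandwich on `(0, t₀]`, the power remainder bounded by Young
  have hyoung : ∀ s ∈ Ioc (0:ℝ) t₀, κ * s ^ θ * (v * s ^ N) ≤ A * (v * s ^ N) + A * β * (v * s ^ (N + 1)) := by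
    intro s hs
    have hs0 : 0 ≤ s := hs.1.le
    have hy := rpow_le_rpow_neg_mul_linear hs0 hβ hθ hθ1
    have hvs : 0 ≤ v * s ^ N := by positivity
    calc κ * s ^ θ * (v * s ^ N) ≤ κ * (β ^ (-θ) * (β * s + 1)) * (v * s ^ N) :=
          mul_le_mul_of_nonneg_right (mul_le_mul_of_nonneg_left hy hκ) hvs
      _ = A * (v * s ^ N) + A * β * (v * s ^ (N + 1)) := by rw [hA]; ring
  have hup : ∀ s ∈ Ioc (0:ℝ) t₀, β * rexp (-(β * s)) * μ.real {ω | F ω ≤ s}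
      ≤ β * v * (1 + A) * (s ^ N * rexp (-(β * s))) + β * v * (A * β) * (s ^ (N + 1) * rexp (-(β * s))) := by
    intro s hs
    have hvs : 0 < v * s ^ N := by have := hs.1; positivity
    have h := (abs_sub_le_iff.1 (hvol s hs.1 hs.2)).1
    rw [sub_le_iff_le_add, div_le_iff₀ hvs] at h
    have hg0 : 0 ≤ β * rexp (-(β * s)) := by positivity
    have hy := hyoung s hs
    calc β * rexp (-(β * s)) * μ.real {ω | F ω ≤ s}
        ≤ β * rexp (-(β * s)) * ((κ * s ^ θ + 1) * (v * s ^ N)) := mul_le_mul_of_nonneg_left h hg0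
      _ ≤ β * rexp (-(β * s)) * ((v * s ^ N) + (A * (v * s ^ N) + A * β * (v * s ^ (N + 1)))) := by
          refine mul_le_mul_of_nonneg_left ?_ hg0
          nlinarith [hy]
      _ = β * v * (1 + A) * (s ^ N * rexp (-(β * s))) + β * v * (A * β) * (s ^ (N + 1) * rexp (-(β * s))) := by
          ring
  have hlo : ∀ s ∈ Ioc (0:ℝ) t₀,
      β * v * (1 - A) * (s ^ N * rexp (-(β * s))) - β * v * (A * β) * (s ^ (N + 1) * rexp (-(β * s)))
      ≤ β * rexp (-(β * s)) * μ.real {ω | F ω ≤ s} := by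
    intro s hs
    have hvs : 0 < v * s ^ N := by have := hs.1; positivity
    have h := (abs_sub_le_iff.1 (hvol s hs.1 hs.2)).2
    rw [sub_le_comm, le_div_iff₀ hvs] at h
    have hg0 : 0 ≤ β * rexp (-(β * s)) := by positivity
    have hy := hyoung s hs
    calc β * v * (1 - A) * (s ^ N * rexp (-(β * s))) - β * v * (A * β) * (s ^ (N + 1) * rexp (-(β * s)))
        = β * rexp (-(β * s)) * ((v * s ^ N) - (A * (v * s ^ N) + A * β * (v * s ^ (N + 1)))) := by ring
      _ ≤ β * rexp (-(β * s)) * ((1 - κ * s ^ θ) * (v * s ^ N)) := by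
          refine mul_le_mul_of_nonneg_left ?_ hg0
          nlinarith [hy]
      _ ≤ β * rexp (-(β * s)) * μ.real {ω | F ω ≤ s} := mul_le_mul_of_nonneg_left h hg0
  -- integrate the sandwich over `(0, t₀]`
  have hiN : IntegrableOn (fun s : ℝ => β * v * (1 + A) * (s ^ N * rexp (-(β * s)))) (Ioc 0 t₀) :=
    (hφN.mono_set Ioc_subset_Ioi_self).const_mul (β * v * (1 + A))
  have hiN' : IntegrableOn (fun s : ℝ => β * v * (1 - A) * (s ^ N * rexp (-(β * s)))) (Ioc 0 t₀) :=
    (hφN.mono_set Ioc_subset_Ioi_self).const_mul (β * v * (1 - A))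
  have hiN1 : IntegrableOn (fun s : ℝ => β * v * (A * β) * (s ^ (N + 1) * rexp (-(β * s)))) (Ioc 0 t₀) :=
    (hφN1.mono_set Ioc_subset_Ioi_self).const_mul (β * v * (A * β))
  have hiU : IntegrableOn (fun s : ℝ => β * v * (1 + A) * (s ^ N * rexp (-(β * s)))
      + β * v * (A * β) * (s ^ (N + 1) * rexp (-(β * s)))) (Ioc 0 t₀) := hiN.add hiN1
  have hiL : IntegrableOn (fun s : ℝ => β * v * (1 - A) * (s ^ N * rexp (-(β * s)))
      - β * v * (A * β) * (s ^ (N + 1) * rexp (-(β * s)))) (Ioc 0 t₀) := hiN'.sub hiN1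
  have hJ1le : ∫ s in Ioc 0 t₀, β * rexp (-(β * s)) * μ.real {ω | F ω ≤ s}
      ≤ β * v * (1 + A) * (∫ s in Ioc 0 t₀, s ^ N * rexp (-(β * s)))
        + β * v * (A * β) * (∫ s in Ioc 0 t₀, s ^ (N + 1) * rexp (-(β * s))) := by
    have h := setIntegral_mono_on (hintgG.mono_set Ioc_subset_Ioi_self) hiU
      measurableSet_Ioc hup
    rw [integral_add hiN hiN1, integral_const_mul, integral_const_mul] at h
    exact h
  have hJ1ge : β * v * (1 - A) * (∫ s in Ioc 0 t₀, s ^ N * rexp (-(β * s)))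
        - β * v * (A * β) * (∫ s in Ioc 0 t₀, s ^ (N + 1) * rexp (-(β * s)))
      ≤ ∫ s in Ioc 0 t₀, β * rexp (-(β * s)) * μ.real {ω | F ω ≤ s} := by
    have h := setIntegral_mono_on hiL (hintgG.mono_set Ioc_subset_Ioi_self)
      measurableSet_Ioc hlo
    rw [integral_sub hiN' hiN1, integral_const_mul, integral_const_mul] at h
    exact h
  -- Gamma-integral bounds on `(0, t₀]`
  have hA_N : ∫ s in Ioc 0 t₀, s ^ N * rexp (-(β * s)) ≤ N ! / β ^ (N + 1) := by
    rw [← intervalIntegral.integral_of_le ht₀.le]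
    exact intervalIntegral_pow_mul_exp_neg_le ht₀.le hβ
  have hA_Nnn : 0 ≤ ∫ s in Ioc 0 t₀, s ^ N * rexp (-(β * s)) :=
    setIntegral_nonneg measurableSet_Ioc fun s hs => mul_nonneg (pow_nonneg hs.1.le _) (Real.exp_pos _).le
  have hA_N1 : ∫ s in Ioc 0 t₀, s ^ (N + 1) * rexp (-(β * s)) ≤ (N + 1) ! / β ^ (N + 1 + 1) := by
    rw [← intervalIntegral.integral_of_le ht₀.le]
    exact intervalIntegral_pow_mul_exp_neg_le ht₀.le hβ
  have h2N : 2 * (N:ℝ) ≤ β * t₀ := window_two_mul_le hβ2 hwin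
  have hA_Nge : N ! / β ^ (N + 1) - 2 / β * t₀ ^ N * rexp (-(β * t₀ / 2))
      ≤ ∫ s in Ioc 0 t₀, s ^ N * rexp (-(β * s)) := by
    have hsplit' : ∫ s in Ioi 0, s ^ N * rexp (-(β * s))
        = (∫ s in Ioc 0 t₀, s ^ N * rexp (-(β * s))) + ∫ s in Ioi t₀, s ^ N * rexp (-(β * s)) := by
      rw [← setIntegral_union (Ioc_disjoint_Ioi le_rfl) measurableSet_Ioi
        (hφN.mono_set Ioc_subset_Ioi_self) (hφN.mono_set (Ioi_subset_Ioi ht₀.le)),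
        Ioc_union_Ioi_eq_Ioi ht₀.le]
    have htail := integral_Ioi_pow_mul_exp_neg_mul_le N hβ ht₀ h2N
    have hfull := integral_pow_mul_exp_neg_mul_Ioi N hβ
    linarith
  -- window consequences
  have hW1 := window_far_tail (N := N) hv hβ2 hwin
  have hW2 := window_truncation_tail (N := N) hv ht₀ hβ2 hwin
  -- algebra: everything in units of `M = v·N!/β^N`
  obtain ⟨M, hM⟩ : ∃ M : ℝ, M = v * N ! / β ^ N := ⟨_, rfl⟩
  have hMpos : 0 < M := by rw [hM]; positivity
  rw [← hM] at hW1 hW2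
  have hE1 : β * v * (N ! / β ^ (N + 1)) = M := by
    rw [hM]; field_simp; ring
  have hE2 : β * v * (A * β) * ((N + 1) ! / β ^ (N + 1 + 1)) = M * (A * (N + 1)) := by
    rw [hM, hfact_succ]; field_simp; ring
  have hE3 : β * v * (2 / β * t₀ ^ N * rexp (-(β * t₀ / 2)))
      = 2 * v * t₀ ^ N * rexp (-(β * t₀ / 2)) := by
    field_simp
  obtain ⟨δ, hδ⟩ : ∃ δ : ℝ, δ = A * ((N : ℝ) + 2) + 1 / β := ⟨_, rfl⟩
  have hβinv : 1 / β ≤ 1 / 4 := one_div_le_one_div_of_le (by norm_num) hβ4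
  have hδ0 : 0 ≤ δ := by rw [hδ]; positivity
  have hδhalf : δ ≤ 1 / 2 := by rw [hδ]; linarith [hAN, hβinv]
  have hMβ : M / β = M * (1 / β) := by ring
  -- upper bound `I ≤ M(1+δ)`
  have hU : ∫ ω, rexp (-(β * F ω)) ∂μ ≤ M * (1 + δ) := by
    have h1 : β * v * (1 + A) * (∫ s in Ioc 0 t₀, s ^ N * rexp (-(β * s))) ≤ β * v * (1 + A) * (N ! / β ^ (N + 1)) :=
      mul_le_mul_of_nonneg_left hA_N (by positivity)
    have h2 : β * v * (A * β) * (∫ s in Ioc 0 t₀, s ^ (N + 1) * rexp (-(β * s)))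
        ≤ β * v * (A * β) * ((N + 1) ! / β ^ (N + 1 + 1)) :=
      mul_le_mul_of_nonneg_left hA_N1 (by positivity)
    have he1 : β * v * (1 + A) * (N ! / β ^ (N + 1)) = M * (1 + A) := by rw [← hE1]; ring
    have hexp : M * (1 + A) + M * (A * (N + 1)) + M / β = M * (1 + δ) := by rw [hδ]; ring
    rw [hI, hsplit]
    linarith [hJ1le, hJ2le, h1, h2, he1, hE2, hW1, hexp]
  -- lower bound `M(1−δ) ≤ I`
  have hL : M * (1 - δ) ≤ ∫ ω, rexp (-(β * F ω)) ∂μ := by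
    have h1A : 0 ≤ β * v * (1 - A) := mul_nonneg (by positivity) (by linarith)
    have h1 : β * v * (1 - A) * (N ! / β ^ (N + 1) - 2 / β * t₀ ^ N * rexp (-(β * t₀ / 2)))
        ≤ β * v * (1 - A) * (∫ s in Ioc 0 t₀, s ^ N * rexp (-(β * s))) :=
      mul_le_mul_of_nonneg_left hA_Nge h1A
    have h2 : β * v * (A * β) * (∫ s in Ioc 0 t₀, s ^ (N + 1) * rexp (-(β * s)))
        ≤ β * v * (A * β) * ((N + 1) ! / β ^ (N + 1 + 1)) :=
      mul_le_mul_of_nonneg_left hA_N1 (by positivity)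
    have hdist : β * v * (1 - A) * (N ! / β ^ (N + 1) - 2 / β * t₀ ^ N * rexp (-(β * t₀ / 2)))
        = (1 - A) * (β * v * (N ! / β ^ (N + 1))) - (1 - A) * (β * v * (2 / β * t₀ ^ N * rexp (-(β * t₀ / 2)))) := by
      ring
    have htr : (1 - A) * (2 * v * t₀ ^ N * rexp (-(β * t₀ / 2))) ≤ M / β := by
      have h0 : 0 ≤ 2 * v * t₀ ^ N * rexp (-(β * t₀ / 2)) := by positivity
      calc (1 - A) * (2 * v * t₀ ^ N * rexp (-(β * t₀ / 2))) ≤ 1 * (2 * v * t₀ ^ N * rexp (-(β * t₀ / 2))) :=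
            mul_le_mul_of_nonneg_right (by linarith) h0
        _ ≤ M / β := by rw [one_mul]; exact hW2
    have hexp : (1 - A) * M - M / β - M * (A * (N + 1)) = M * (1 - δ) := by rw [hδ]; ring
    rw [hI, hsplit]
    rw [hdist, hE1, hE3] at h1
    linarith [hJ1ge, hJ2nn, h1, h2, hE2, htr, hexp]
  -- logs
  have key := abs_log_sub_log_le_of_sandwich hMpos hδ0 hδhalf hL hU
  have hlogM : Real.log M = Real.log v + Real.log (N ! : ℝ) - N * Real.log β := by
    rw [hM, Real.log_div (by positivity) (by positivity), Real.log_mul hv.ne' (by positivity),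
      Real.log_pow]
  have h2δ : 2 * δ = 2 * κ * ((N : ℝ) + 2) * β ^ (-θ) + 2 / β := by rw [hδ, hA]; ring
  rw [← hlogM, ← h2δ]
  exact key

end Summit.QuantumFields.YangMills.Theorems.SwapVirialDeficit.SharpSigma

end
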